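import Summits.BirchSwinnertonDyer.BirchSwinnertonDyer.Theorems.ManinLocalTwoThreeRootSqueezeElevenNinetyNine
import Summits.BirchSwinnertonDyer.BirchSwinnertonDyer.Theorems.ManinLocalTwoThreeTwistRootFormEleven
import HarnessLib

/-!
# The `χ₋₃`-image of `11a` at LEVEL 99 (C3, `9 ∥ 99`) from (S2)₁₁ on `X₀(99)`: `|c| = 1 ∧ 3 ∤ c` for every lattice-optimal `X₀(99)`-datum whose
# newform is `(ι₁φ₁₁)^{χ₋₃}` — and the odd twist family at the levels `99 ∣ N`

Cell `bsd-f2-manin`, route `ManinLocalTwoThree`, crux C3 `ManinPrimeToThreeAtNine` (stmt-BirchSwinnertonDyer-22968: `3² ∣ 99`); prover seat p3 gen 27;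
`--supports` (helper).  p3 g26's ENGINE 68.A (`…OddTwistRootFormTransport`) fed with this seat's level-`99` root squeeze
`RootSqueezeElevenNinetyNine.periodLatticeLe_iota99_phi11` (`Λ(ι₁φ₁₁) ⊆ Λ_Néron(11a1)` for the `Γ₀(99)`-periods) and the root curve facts of
`…TwistRootFormEleven` (`11a1` globally minimal, good at every `p ≠ 11`):
* `abs_maninConstant_eq_one_of_cuspCoeff_chi_phi11_ninetyNine`: `p` odd, `p ≠ 11`, `99 ∣ N`, `p² ∣ N`, `aₙ(D.f) = χ_p(n)·aₙ(φ₁₁)` ⟹ `|c(D)| = 1`;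
* **`shapes_ninetyNine`** (`p = 3`, `N = 99`): `|c| = 1 ∧ 3 ∤ c` on the row `11a ⊗ χ₋₃` of `X₀(99)` — the C3 shape for that class, modulo its
  identification by a pinning of level `99` (not η-spanned; an's Hecke-closure kernel), which is NOT claimed here; `shapes_eightNinetyOne` (`p = 3`,
  `N = 891 = 81·11`).
HONEST SCOPE: hypothesis-shaped; unconditional (standard axioms); nothing here proves C3 (∀ N), Manin's conjecture or BSD.  No named fact, no sorry.
[cite: Stevens1989, Lemma (5.2) p. 96, Lemma (5.4) p. 97] [cite: AgasheRibetStein2006, §§1–2] [cite: CremonaAlgorithms1997, Table 1 (11a1, 99)]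
-/

set_option autoImplicit false
-- lint-debt: the directory name repeats the summit name (sibling precedent `ManinLocalTwoThreeTwistRootFormEleven.lean`)
set_option linter.dupNamespace false

noncomputable section

open scoped MatrixGroups ModularForm
open ModularForm CongruenceSubgroup WeierstrassCurve
open Literature.NumberTheory.EllipticCurves Literature.NumberTheory.EllipticCurves.ModularForms

namespace Summit.BirchSwinnertonDyer.BirchSwinnertonDyer.Theorems.ManinLocalTwoThree.RootSqueezeElevenNinetyNine

open Summit.BirchSwinnertonDyer.BirchSwinnertonDyer.Theorems.ManinLocalTwoThree.RootSqueezeEleven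

/-- **`|c| = 1` on every odd twist image of `ι₁φ₁₁ ∈ S₂(Γ₀(99))`** (`p` odd, `p ≠ 11`; `99 ∣ N`, `p² ∣ N`; `aₙ(D.f) = χ(n)·aₙ(φ₁₁)` for all `n`).
[cite: Stevens1989, Lemma (5.2) p. 96, Lemma (5.4) p. 97] [cite: AgasheRibetStein2006, §§1–2] -/
theorem abs_maninConstant_eq_one_of_cuspCoeff_chi_phi11_ninetyNine {p : ℕ} [Fact p.Prime] (hp2 : p ≠ 2) (hp11 : p ≠ 11)
    {χ : DirichletCharacter ℂ p} (hχ : χ.IsQuadratic) (hprim : χ.IsPrimitive)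
    (W : WeierstrassCurve ℚ) [W.IsElliptic] [W.IsGloballyMinimal] {N : ℕ} [NeZero N]
    (D : ModularParametrizationData W N) (h99 : 99 ∣ N) (hpN : p ^ 2 ∣ N)
    (hf : ∀ n : ℕ, cuspCoeff D.f n = χ n * cuspCoeff cuspFormEtaProductEleven n)
    (hopt : ∀ z ∈ D.L.lattice, ∃ w ∈ periodLattice D.f, z = D.c * w) :
    |D.maninConstant| = 1 := by
  haveI := isElliptic_elevenA1
  haveI := isGloballyMinimal_elevenA1
  obtain ⟨L₀, h2, h3⟩ := ((⟨0, -1, 1, -10, -20⟩ : WeierstrassCurve ℚ).baseChange ℂ).exists_periodPair_of_isElliptic'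
  have hL₀ : IsNeronLatticeOf ((⟨0, -1, 1, -10, -20⟩ : WeierstrassCurve ℚ).baseChange ℂ) L₀ := ⟨h2, h3⟩
  exact OddTwistRootForm.abs_maninConstant_eq_one_of_rootForm_oddTwist hp2 hχ hprim _ (⟨0, -1, 1, -10, -20⟩ : WeierstrassCurve ℚ)
    L₀ hL₀ (periodLatticeLe_iota99_phi11 hL₀) (Or.inl (hasGoodReductionAtPrime_elevenA1 hp11)) W D h99 hpN
    (fun n ↦ by rw [hf n, cuspCoeff_degeneracyMap0_one (⟨9, rfl⟩ : 11 ∣ 99)]) hopt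

/-- No integer `q` with `|q| ≠ 1` divides `c` on the family. [cite: AgasheRibetStein2006, §§1–2] -/
theorem not_dvd_maninConstant_of_cuspCoeff_chi_phi11_ninetyNine {p : ℕ} [Fact p.Prime] (hp2 : p ≠ 2) (hp11 : p ≠ 11)
    {χ : DirichletCharacter ℂ p} (hχ : χ.IsQuadratic) (hprim : χ.IsPrimitive)
    (W : WeierstrassCurve ℚ) [W.IsElliptic] [W.IsGloballyMinimal] {N : ℕ} [NeZero N]
    (D : ModularParametrizationData W N) (h99 : 99 ∣ N) (hpN : p ^ 2 ∣ N)
    (hf : ∀ n : ℕ, cuspCoeff D.f n = χ n * cuspCoeff cuspFormEtaProductEleven n)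
    (hopt : ∀ z ∈ D.L.lattice, ∃ w ∈ periodLattice D.f, z = D.c * w) {q : ℤ} (hq : q.natAbs ≠ 1) :
    ¬ q ∣ D.maninConstant := by
  intro h
  have h1 := abs_maninConstant_eq_one_of_cuspCoeff_chi_phi11_ninetyNine hp2 hp11 hχ hprim W D h99 hpN hf hopt
  have hn : D.maninConstant.natAbs = 1 := by
    rw [Int.abs_eq_natAbs] at h1
    exact_mod_cast h1
  have h2 : q.natAbs ∣ 1 := hn ▸ Int.natAbs_dvd_natAbs.mpr h
  exact hq (Nat.dvd_one.mp h2)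

/-- **The C3 shape on the row `11a ⊗ χ₋₃` of `X₀(99)`**: `|c| = 1 ∧ 3 ∤ c` for every lattice-optimal `X₀(99)`-datum of a globally minimal `W` whose
newform is the twist of `φ₁₁` by the primitive quadratic character mod `3`.  No printed fact. [cite: CremonaAlgorithms1997, Table 1 (99)] -/
theorem shapes_ninetyNine [Fact (Nat.Prime 3)] (χ : DirichletCharacter ℂ 3) (hχ : χ.IsQuadratic) (hprim : χ.IsPrimitive)
    (W : WeierstrassCurve ℚ) [W.IsElliptic] [W.IsGloballyMinimal] [NeZero (99 : ℕ)] (D : ModularParametrizationData W 99)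
    (hf : ∀ n : ℕ, cuspCoeff D.f n = χ n * cuspCoeff cuspFormEtaProductEleven n)
    (hopt : ∀ z ∈ D.L.lattice, ∃ w ∈ periodLattice D.f, z = D.c * w) :
    |D.maninConstant| = 1 ∧ ¬ (3 : ℤ) ∣ D.maninConstant :=
  ⟨abs_maninConstant_eq_one_of_cuspCoeff_chi_phi11_ninetyNine (p := 3) (by norm_num) (by norm_num) hχ hprim W D (by norm_num) (by norm_num) hf hopt,
   not_dvd_maninConstant_of_cuspCoeff_chi_phi11_ninetyNine (p := 3) (by norm_num) (by norm_num) hχ hprim W D (by norm_num) (by norm_num) hf hopt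
     (by decide)⟩

/-- **The C3 shape on the `χ₋₃`-image of `φ₁₁` at `891 = 3⁴·11`** (`99 ∣ 891`, `9 ∣ 891`): `|c| = 1 ∧ 3 ∤ c`.  No printed fact. [cite: CremonaAlgorithms1997, Table 1 (891)] -/
theorem shapes_eightNinetyOne [Fact (Nat.Prime 3)] (χ : DirichletCharacter ℂ 3) (hχ : χ.IsQuadratic) (hprim : χ.IsPrimitive)
    (W : WeierstrassCurve ℚ) [W.IsElliptic] [W.IsGloballyMinimal] [NeZero (891 : ℕ)] (D : ModularParametrizationData W 891)
    (hf : ∀ n : ℕ, cuspCoeff D.f n = χ n * cuspCoeff cuspFormEtaProductEleven n)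
    (hopt : ∀ z ∈ D.L.lattice, ∃ w ∈ periodLattice D.f, z = D.c * w) :
    |D.maninConstant| = 1 ∧ ¬ (3 : ℤ) ∣ D.maninConstant :=
  ⟨abs_maninConstant_eq_one_of_cuspCoeff_chi_phi11_ninetyNine (p := 3) (by norm_num) (by norm_num) hχ hprim W D (by norm_num) (by norm_num) hf hopt,
   not_dvd_maninConstant_of_cuspCoeff_chi_phi11_ninetyNine (p := 3) (by norm_num) (by norm_num) hχ hprim W D (by norm_num) (by norm_num) hf hopt
     (by decide)⟩

end Summit.BirchSwinnertonDyer.BirchSwinnertonDyer.Theorems.ManinLocalTwoThree.RootSqueezeElevenNinetyNine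

end
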